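import Mathlib

/-!
# Triage scratch (crux-triage r1-1, stmt-QuantumFields-13995): why `KacRiceCrossingBound`
(Sketch-ideator2.lean, card `kac-rice-hermitian-dos`) is mis-typed

The first lemma bounds `crossingCount U s α β` (real roots of the cell's characteristic polynomial
with `-re ∈ [α, β]`, counted WITH multiplicity) by
`Filter.liminf (fun η => (1/(2η)) * ∫ μ in Set.Icc α β, #{i : |λ_i(H_c(μ))| < η}) (𝓝[>] 0)`.
Two junk mechanisms make the right-hand side `0` while the left-hand side is positive:

1. `α = β`: the set integral over the one-point interval `Icc a a` vanishes identically, so the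
   bound reads `crossingCount ≤ 0`; but the one-site cell `s = (2,2,2,2)` has `det (wilsonCell U μ x s)
   = (μ+4)^{#cell}` for EVERY gauge field (Disproof.lean §4 `det_wilsonCell_two`), i.e.
   `crossingCount U s (-4) (-4) = #cell > 0`.
2. `Filter.liminf` into `ℝ` of a function tending to `+∞` is the junk value `0`
   (`Real.sSup` of a set unbounded above), and the Kac–Rice integrand DOES blow up like `η^{-1/2}`
   at tangential zeros of the eigenvalue branches (defective real eigenvalues = chirality-0
   crossings, e.g. the needle cell `s = (3,2,2,2)`: `M - 4` nilpotent of order 2, twelve branches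
   vanishing quadratically at `μ = -4` for every `U`) — exactly the pair-collision configurations the
   crux names as its failure mode.

Repair (for the crux-plan seat): integrate over `Icc (α - η) (β + η)` (or `ℝ`), and state the bound
in `ℝ≥0∞` (`∫⁻`, honest `liminf`) or only for `E`-almost every `U` / semisimple crossings.
-/

open MeasureTheory Filter Set Topology

/-- Mechanism 1: a set integral over a one-point closed interval is zero. -/
example (a : ℝ) (f : ℝ → ℝ) : ∫ μ in Set.Icc a a, f μ = 0 := by
  have h : (volume : Measure ℝ).restrict (Set.Icc a a) = 0 := by
    rw [Set.Icc_self, Measure.restrict_eq_zero]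
    exact measure_singleton a
  rw [h, integral_zero_measure]

/-- Hence the whole Kac–Rice right-hand side at `α = β` is the liminf of the constant `0`. -/
example (g : ℝ → ℝ → ℝ) (a : ℝ) :
    Filter.liminf (fun η : ℝ => (1 / (2 * η)) * ∫ μ in Set.Icc a a, g η μ) (𝓝[>] (0 : ℝ)) = 0 := by
  have hfun : (fun η : ℝ => (1 / (2 * η)) * ∫ μ in Set.Icc a a, g η μ) = fun _ => (0 : ℝ) := by
    funext η
    have h : (volume : Measure ℝ).restrict (Set.Icc a a) = 0 := by
      rw [Set.Icc_self, Measure.restrict_eq_zero]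
      exact measure_singleton a
    rw [h, integral_zero_measure, mul_zero]
  rw [hfun, Filter.liminf_const]

/-- Mechanism 2: the real-valued `liminf` of a function tending to `+∞` along `𝓝[>] 0` is the
junk value `0`. -/
example : Filter.liminf (fun η : ℝ => 1 / η) (𝓝[>] (0 : ℝ)) = 0 := by
  rw [Filter.liminf_eq]
  have hset : {a : ℝ | ∀ᶠ η in 𝓝[>] (0 : ℝ), a ≤ 1 / η} = Set.univ := by
    refine Set.eq_univ_of_forall fun a => ?_
    show ∀ᶠ η in 𝓝[>] (0 : ℝ), a ≤ 1 / η
    have hpos : (0 : ℝ) < 1 / max a 1 := by positivity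
    filter_upwards [Ioo_mem_nhdsGT hpos] with η hη
    rw [Set.mem_Ioo] at hη
    have hη1 : 0 < η := hη.1
    have hmax : 0 < max a 1 := by positivity
    have h1 : max a 1 < 1 / η := by
      rw [lt_div_iff₀ hη1]
      calc max a 1 * η < max a 1 * (1 / max a 1) := mul_lt_mul_of_pos_left hη.2 hmax
        _ = 1 := by field_simp
    exact le_of_lt (lt_of_le_of_lt (le_max_left a 1) h1)
  rw [hset]
  exact Real.sSup_univ
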